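import Literature.NumberTheory.EllipticCurves.SerreOpenImageReductionInertiaProofs
import Literature.NumberTheory.EllipticCurves.SupersingularDensityDeuringCriterionProofs
import HarnessLib

/-!
# An arithmetic Frobenius at the place acts on the reduction `E(ℚ̄) → Ẽ(𝔽̄_p)` as the
# `p`-power Frobenius; on `p`-power torsion it acts, modulo the kernel of reduction, by `a_p`
# (Serre 1972, §1.11)

Topic `NumberTheory/EllipticCurves`.  Theorems only (nothing is defined, no named fact).  Cell
`b2b-bsdres` (run/shared/lean/b2b/bsd-rank1-residual/), HONEST FRAMING: the cell deletes the
COMBINATION-SHAPED residual classes of the rank-`≤ 1` BSD formula from PUBLISHED theorems only and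
types the rest; this is not "finishing BSD".  This file is the Frobenius companion of
`SerreOpenImageReductionInertiaProofs` (`geomReduction_smul_of_mem_inertia`: the inertia group
`I_𝔓` acts TRIVIALLY on the reduction).  For an elliptic curve `E = W/ℚ` in global minimal form, a
prime `p ∤ Δ_W` of good reduction, the prime `𝔓` of `\bar ℤ` cut out by the place `placeOver p`
(`exists_ideal_placeOver`) and an ARITHMETIC FROBENIUS `σ ∈ Γ_ℚ` at `𝔓`
(`IsArithFrobAt (𝓞 ℚ) σ 𝔓`: `σ x ≡ x^p (mod 𝔓)` on `\bar ℤ`; it exists,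
`exists_isArithFrobAt_of_mem_primesAbove_holds`):

* `valuation_smul_sub_pow_lt_one_of_isArithFrobAt` — `σ z ≡ z^p (mod 𝔪_𝔓)` on the whole valuation
  ring `𝒪_𝔓` of the place (`𝒪_𝔓 = \bar ℤ_𝔓`: `z = s/t`, `t ∉ 𝔓`);
* `geomReduction_smul_of_isArithFrobAt` — **`red (σ • P) = Frob_p • red P`** for every
  `P ∈ E(ℚ̄)`, where `red = geomReduction : E(ℚ̄) →+ Ẽ(𝔽̄_p)` and `Frob_p ∈ Γ_{𝔽_p}` is the
  `p`-power Frobenius (`x ↦ x^p`, `exists_frobenius_absoluteGaloisGroup`): Serre, Invent. Math. 15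
  (1972) §1.11, proof of Prop. 11, "`G` opère sur `Ẽ_p` par l'intermédiaire de l'homomorphisme
  canonique `G → G_k` et de l'action naturelle de `G_k` sur `Ẽ(k̄)`"; Silverman AEC VII.2, VIII.§1;
* `frob_smul_eq_frobeniusTrace_smul_of_zsmul_eq_zero` — on the `p`-torsion of `Ẽ(𝔽̄_p)` (`p Q = 0`,
  i.e. `k = 1`; on `Ẽ[p^k]`, `k ≥ 2`, Frobenius is the unit root of `X² - a_pX + p`, not `a_p`) the
  Frobenius acts as the scalar `a_p = p + 1 - #Ẽ(𝔽_p)` (Manin's relation `φ² - a φ + p = 0` on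
  points, tree `frobenius_frobenius_sub_trace_smul_add_card_smul`, AEC V.2.3.1, with `p Q = 0`);
* `geomReduction_smul_eq_frobeniusTrace_smul` — hence **`red (σ • P) = a_p • red P` for every
  `P ∈ E[p](ℚ̄)`** (`k = 1`): Frobenius acts on `E[p]/X_p ≅ red(E[p]) ⊆ Ẽ[p]` (`X_p` the kernel of
  reduction on `E[p]`, Serre's line at an ordinary `p`) by `a_p (mod p)` — the unramified character
  of `ρ̄_{E,p}|_{G_p}` takes the value `a_p` at Frobenius (Serre 1972 §1.11 (1); the "ordinary
  dictionary" behind the word ANOMALOUS, Mazur 1972: `a_p ≡ 1 (mod p)` iff Frobenius acts trivially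
  on `Ẽ[p]`);
* `geomReduction_smul_eq_self_of_dvd_frobeniusTrace_sub_one` and
  `dvd_frobeniusTrace_sub_one_of_geomReduction_smul_eq_self` — the two halves of that dictionary:
  `a_p ≡ 1 (mod p)` ⇒ `red (σ • P) = red P` on `E[p]`; conversely one `P ∈ E[p]` with
  `red P ≠ Õ` and `red (σ • P) = red P` forces `a_p ≡ 1 (mod p)`.

Used by the cell for the transcription flag `CGS25-anom-dictionary` (Castella–Grossi–Skinner 2025
Thm. A/D "`φ|_{G_p} ≠ 1, ω`" vs. the census predicate `¬anom(p)`): see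
`Rank1Residual/EisensteinGoodComplement.lean` and `b2b-bsdres-x1a/X1-CHAIN.md` §14.

## References
* [Serre1972] J.-P. Serre, Invent. Math. 15 (1972) 259–331, §1.11 (1), Prop. 11 and its proof.
* [SilvermanAEC2009] J. H. Silverman, *The Arithmetic of Elliptic Curves*, 2nd ed., V.2.3.1,
  VII.2.1, VIII.§1.
* [Mazur1972] B. Mazur, Invent. Math. 18 (1972) 183–266, §1 (anomalous primes).
-/

noncomputable section

open scoped Classical NumberField Pointwise
open IsDedekindDomain Field WeierstrassCurve

namespace Literature.NumberTheory.EllipticCurves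

open Literature.NumberTheory.GaloisRepresentations Rat.HeightOneSpectrum

variable {p : ℕ} [Fact p.Prime]

/-! ### The exponent of an arithmetic Frobenius above `p` is `p` -/

omit [Fact p.Prime] in
/-- For a prime `𝔓` of `\bar ℤ` above the place `v` of `ℚ` at `p`: `#(ℤ / 𝔓 ∩ ℤ) = p`, so
`IsArithFrobAt (𝓞 ℚ) σ 𝔓` reads `σ x ≡ x^p (mod 𝔓)`. [folklore] -/
theorem natCard_quotient_under_eq_of_mem_primesAbove {v : HeightOneSpectrum (𝓞 ℚ)}
    (hv : (primesEquiv v : ℕ) = p) {𝔓 : Ideal (absIntegers (𝓞 ℚ) ℚ)} (h𝔓 : 𝔓 ∈ v.primesAbove) :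
    Nat.card (𝓞 ℚ ⧸ 𝔓.under (𝓞 ℚ)) = p := by
  rw [v.card_quotient_under_eq_residueCard h𝔓]
  have h : Ideal.span {(natGenerator v : ℤ)} =
      v.asIdeal.map (Rat.IsIntegralClosure.intEquiv (𝓞 ℚ) : 𝓞 ℚ →+* ℤ) := span_natGenerator v
  rw [v.residueCard_eq_card_quotient, Nat.card_congr ((Ideal.quotientEquiv _ _
    (Rat.IsIntegralClosure.intEquiv (𝓞 ℚ)) h).trans (Int.quotientSpanNatEquivZMod _)).toEquiv,
    Nat.card_zmod]
  exact hv

omit [Fact p.Prime] in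
/-- Unfolded arithmetic Frobenius above `p`: `σ • x - x^p ∈ 𝔓` for every `x ∈ \bar ℤ`. [folklore] -/
theorem smul_sub_pow_mem_of_isArithFrobAt {v : HeightOneSpectrum (𝓞 ℚ)}
    (hv : (primesEquiv v : ℕ) = p) {𝔓 : Ideal (absIntegers (𝓞 ℚ) ℚ)} (h𝔓 : 𝔓 ∈ v.primesAbove)
    {σ : absoluteGaloisGroup ℚ} (hσ : IsArithFrobAt (𝓞 ℚ) σ 𝔓) (x : absIntegers (𝓞 ℚ) ℚ) :
    σ • x - x ^ p ∈ 𝔓 := by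
  have h := hσ x
  rw [natCard_quotient_under_eq_of_mem_primesAbove hv h𝔓] at h
  exact h

/-! ### The Frobenius stabilises the place and raises residues to the `p`-th power -/

/-- An arithmetic Frobenius at `𝔓` stabilises the place: `σ 𝒪_𝔓 = 𝒪_𝔓` (`σ ∈ D_𝔓`, Mathlib
`IsArithFrobAt.mem_stabilizer`, and `D_𝔓` is the stabiliser of the place,
`Ideal.decompositionSubgroup_eq_of_valuationSubring_holds`).
[cite: SerreLocalFields1979, Ch. I §7 Prop. 19–21] -/
theorem smul_placeOver_eq_of_isArithFrobAt {𝔓 : Ideal (absIntegers (𝓞 ℚ) ℚ)}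
    (hmem : ∀ x : absIntegers (𝓞 ℚ) ℚ, x ∈ 𝔓 ↔ (x : AlgebraicClosure ℚ) ∈ (placeOver p).nonunits)
    {v : HeightOneSpectrum (𝓞 ℚ)} (h𝔓 : 𝔓 ∈ v.primesAbove)
    {σ : absoluteGaloisGroup ℚ} (hσ : IsArithFrobAt (𝓞 ℚ) σ 𝔓) :
    (absoluteGaloisGroup.toAlgEquiv ℚ σ) • placeOver p = placeOver p := by
  haveI : Algebra.IsAlgebraic ℚ (AlgebraicClosure ℚ) := AlgebraicClosure.isAlgebraic ℚ
  haveI : 𝔓.IsPrime := h𝔓.1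
  have hD := Ideal.decompositionSubgroup_eq_of_valuationSubring_holds (R := 𝓞 ℚ) (K := ℚ)
    (L := AlgebraicClosure ℚ) (placeOver p) (fun x ↦ coe_absIntegers_mem_placeOver p x) 𝔓 hmem
  have hσD : σ ∈ 𝔓.decompositionSubgroup (absoluteGaloisGroup ℚ) := hσ.mem_stabilizer
  have hσD' : absoluteGaloisGroup.toAlgEquiv ℚ σ ∈ (placeOver p).decompositionSubgroup ℚ := by
    rw [← hD]; exact hσD
  exact hσD'

/-- **`σ z ≡ z^p (mod 𝔪_𝔓)` for every `z` in the valuation ring of the place** (`𝒪_𝔓 = \bar ℤ_𝔓`: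
`z t = s` with `s, t ∈ \bar ℤ`, `t ∉ 𝔓`, `Ideal.exists_mul_eq_of_mem_valuationSubring`; then
`σ z - z^p = ((σ s - s^p) t^p + s^p (t^p - σ t)) / (σ t · t^p)` has numerator in `𝔪` and unit
denominator). [cite: SerreLocalFields1979, Ch. I §7 Prop. 19–21] -/
theorem valuation_smul_sub_pow_lt_one_of_isArithFrobAt {𝔓 : Ideal (absIntegers (𝓞 ℚ) ℚ)}
    (hmem : ∀ x : absIntegers (𝓞 ℚ) ℚ, x ∈ 𝔓 ↔ (x : AlgebraicClosure ℚ) ∈ (placeOver p).nonunits)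
    {v : HeightOneSpectrum (𝓞 ℚ)} (hv : (primesEquiv v : ℕ) = p) (h𝔓 : 𝔓 ∈ v.primesAbove)
    {σ : absoluteGaloisGroup ℚ} (hσ : IsArithFrobAt (𝓞 ℚ) σ 𝔓)
    {z : AlgebraicClosure ℚ} (hz : z ∈ placeOver p) :
    (placeOver p).valuation (σ • z - z ^ p) < 1 := by
  haveI : Algebra.IsAlgebraic ℚ (AlgebraicClosure ℚ) := AlgebraicClosure.isAlgebraic ℚ
  haveI : 𝔓.IsPrime := h𝔓.1
  set w := (placeOver p).valuation with hw
  obtain ⟨s, t, ht, hzt⟩ := Ideal.exists_mul_eq_of_mem_valuationSubring (R := 𝓞 ℚ) (K := ℚ)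
    (placeOver p) 𝔓 hmem hz
  have hσD : σ • 𝔓 = 𝔓 := hσ.mem_stabilizer
  -- valuations of `s, t, σ s - s^p, σ t - t^p, σ t`
  have hs1 : w s ≤ 1 := (ValuationSubring.valuation_le_one_iff _ _).mpr
    (coe_absIntegers_mem_placeOver p s)
  have ht1 : w t = 1 := by
    have h := ht
    rw [hmem, ValuationSubring.mem_nonunits_iff, not_lt] at h
    exact le_antisymm ((ValuationSubring.valuation_le_one_iff _ _).mpr
      (coe_absIntegers_mem_placeOver p t)) h
  have hσt : σ • t ∉ 𝔓 := by rwa [← hσD, Ideal.smul_mem_pointwise_smul_iff]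
  have hσt1 : w (σ • (t : AlgebraicClosure ℚ)) = 1 := by
    have h := hσt
    rw [hmem, ValuationSubring.mem_nonunits_iff, not_lt, integralClosure.coe_smul] at h
    exact le_antisymm ((ValuationSubring.valuation_le_one_iff _ _).mpr
      (coe_absIntegers_mem_placeOver p (σ • t))) h
  have hds : w (σ • (s : AlgebraicClosure ℚ) - (s : AlgebraicClosure ℚ) ^ p) < 1 := by
    have h := (hmem _).mp (smul_sub_pow_mem_of_isArithFrobAt hv h𝔓 hσ s)
    rwa [ValuationSubring.mem_nonunits_iff, AddSubgroupClass.coe_sub, integralClosure.coe_smul,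
      SubmonoidClass.coe_pow] at h
  have hdt : w (σ • (t : AlgebraicClosure ℚ) - (t : AlgebraicClosure ℚ) ^ p) < 1 := by
    have h := (hmem _).mp (smul_sub_pow_mem_of_isArithFrobAt hv h𝔓 hσ t)
    rwa [ValuationSubring.mem_nonunits_iff, AddSubgroupClass.coe_sub, integralClosure.coe_smul,
      SubmonoidClass.coe_pow] at h
  -- `σ z - z^p = ((σ s - s^p) t^p + s^p (t^p - σ t)) / (σ t · t^p)`
  have ht0 : (t : AlgebraicClosure ℚ) ≠ 0 := by
    intro h0; rw [h0, map_zero] at ht1; exact zero_ne_one ht1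
  have hσt0 : σ • (t : AlgebraicClosure ℚ) ≠ 0 := by
    intro h0; rw [h0, map_zero] at hσt1; exact zero_ne_one hσt1
  have hz' : z = (s : AlgebraicClosure ℚ) / t := by rw [eq_div_iff ht0, hzt]
  set S : AlgebraicClosure ℚ := (s : AlgebraicClosure ℚ) with hS
  set T : AlgebraicClosure ℚ := (t : AlgebraicClosure ℚ) with hT
  have hTp0 : T ^ p ≠ 0 := pow_ne_zero _ ht0
  have hτz : σ • z = (σ • S) / (σ • T) := by
    rw [hz', absoluteGaloisGroup.smul_def, absoluteGaloisGroup.smul_def,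
      absoluteGaloisGroup.smul_def, map_div₀]
  have hnum : w ((σ • S - S ^ p) * T ^ p + S ^ p * (T ^ p - σ • T)) < 1 := by
    refine Valuation.map_add_lt _ ?_ ?_
    · rw [map_mul, map_pow, ht1, one_pow, mul_one]; exact hds
    · rw [map_mul, map_pow]
      have hTσ : w (T ^ p - σ • T) < 1 := by
        rw [← Valuation.map_neg, neg_sub]; exact hdt
      calc w S ^ p * w (T ^ p - σ • T) ≤ 1 * w (T ^ p - σ • T) := by
            gcongr; exact pow_le_one₀ zero_le hs1
        _ < 1 := by rw [one_mul]; exact hTσ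
  have hcalc : σ • z - z ^ p = ((σ • S - S ^ p) * T ^ p + S ^ p * (T ^ p - σ • T)) /
      (σ • T * T ^ p) := by
    rw [hτz, hz', div_pow, div_sub_div _ _ hσt0 hTp0]
    congr 1
    ring
  rw [hcalc, map_div₀, map_mul, map_pow, hσt1, ht1, one_pow, mul_one, div_one]
  exact hnum

/-! ### The Frobenius acts on the reduction as the `p`-power Frobenius -/

/-- **`red (σ • P) = Frob_p • red P`** (Serre 1972, §1.11, proof of Prop. 11; Silverman VIII.§1):
for the prime `𝔓` of `\bar ℤ` cut out by the place `placeOver p`, an arithmetic Frobenius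
`σ ∈ Γ_ℚ` at `𝔓`, the `p`-power Frobenius `Frob_p ∈ Γ_{𝔽_p}` (`φ • x = x^p` on `𝔽̄_p`) and every
`P ∈ E(ℚ̄)`: `geomReduction hΔ (σ • P) = φ • geomReduction hΔ P`. Integral points: the residues of
`σ x, σ y` are the `p`-th powers of those of `x, y` (`valuation_smul_sub_pow_lt_one_of_isArithFrobAt`);
non-integral points: both sides are `Õ` (`σ 𝒪_𝔓 = 𝒪_𝔓`).
[cite: Serre1972, §1.11, Prop. 11 (proof)] -/
theorem geomReduction_smul_of_isArithFrobAt {W : WeierstrassCurve ℚ} [W.IsGloballyMinimal]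
    [W.IsElliptic] (hΔ : ¬ (p : ℤ) ∣ minimalDiscriminantInt W)
    {𝔓 : Ideal (absIntegers (𝓞 ℚ) ℚ)}
    (hmem : ∀ x : absIntegers (𝓞 ℚ) ℚ, x ∈ 𝔓 ↔ (x : AlgebraicClosure ℚ) ∈ (placeOver p).nonunits)
    {v : HeightOneSpectrum (𝓞 ℚ)} (hv : (primesEquiv v : ℕ) = p) (h𝔓 : 𝔓 ∈ v.primesAbove)
    {σ : absoluteGaloisGroup ℚ} (hσ : IsArithFrobAt (𝓞 ℚ) σ 𝔓)
    {φ : absoluteGaloisGroup (ZMod p)} (hφ : ∀ x : AlgebraicClosure (ZMod p), φ • x = x ^ p)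
    (P : W.geomPoints) :
    geomReduction hΔ (σ • P) = φ • geomReduction hΔ P := by
  have hstab := smul_placeOver_eq_of_isArithFrobAt hmem h𝔓 hσ
  have hmemσ : ∀ z : AlgebraicClosure ℚ, σ • z ∈ placeOver p ↔ z ∈ placeOver p := by
    intro z
    conv_lhs => rw [← hstab]
    rw [absoluteGaloisGroup.smul_def]
    exact ValuationSubring.smul_mem_pointwise_smul_iff
  have hvI := integers_placeOver p
  rcases P with _ | ⟨x, y, hxy⟩
  · change geomReduction hΔ (σ • (0 : W.geomPoints)) = φ • geomReduction hΔ (0 : W.geomPoints)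
    rw [smul_zero, map_zero, smul_zero]
  · set ψ : AlgebraicClosure ℚ →ₐ[ℚ] AlgebraicClosure ℚ :=
      (absoluteGaloisGroup.toAlgEquiv ℚ σ).toAlgHom with hψ
    have hψinj : Function.Injective ψ := (absoluteGaloisGroup.toAlgEquiv ℚ σ).injective
    have hσxy : (W.baseChange (AlgebraicClosure ℚ)).toAffine.Nonsingular (σ • x) (σ • y) :=
      (Affine.baseChange_nonsingular (W := W.toAffine) hψinj x y).mpr hxy
    change geomReduction hΔ (Affine.Point.some (σ • x) (σ • y) hσxy) =
      φ • geomReduction hΔ (Affine.Point.some x y hxy)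
    by_cases hx : x ∈ placeOver p
    · -- integral point: residues are raised to the `p`-th power
      have heq : ((placeModel p W).baseChange (AlgebraicClosure ℚ)).toAffine.Equation x y := by
        rw [placeModel_baseChange]; exact hxy.left
      have hy1 : (placeOver p).valuation y ≤ 1 :=
        v_Y_le_one_of_v_X_le_one (W := placeModel p W) hvI heq
          ((ValuationSubring.valuation_le_one_iff _ _).mpr hx)
      have hy : y ∈ placeOver p := (ValuationSubring.valuation_le_one_iff _ _).mp hy1
      set a : placeOver p := ⟨x, hx⟩ with ha
      set b : placeOver p := ⟨y, hy⟩ with hb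
      set a' : placeOver p := ⟨σ • x, (hmemσ x).mpr hx⟩ with ha'
      set b' : placeOver p := ⟨σ • y, (hmemσ y).mpr hy⟩ with hb'
      obtain ⟨h₁, hred₁⟩ := geomReduction_some_coe hΔ a b hxy
      obtain ⟨h₂, hred₂⟩ := geomReduction_some_coe hΔ a' b' hσxy
      have hres : ∀ c c' : placeOver p,
          (placeOver p).valuation ((c' : AlgebraicClosure ℚ) - (c : AlgebraicClosure ℚ) ^ p) < 1 →
          placeResidueMap p c' = placeResidueMap p c ^ p := by
        intro c c' hcc'
        rw [← map_pow, ← sub_eq_zero, ← map_sub, placeResidueMap_eq_zero_iff]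
        simpa only [AddSubgroupClass.coe_sub, SubmonoidClass.coe_pow] using hcc'
      have hra : placeResidueMap p a' = placeResidueMap p a ^ p :=
        hres a a' (valuation_smul_sub_pow_lt_one_of_isArithFrobAt hmem hv h𝔓 hσ hx)
      have hrb : placeResidueMap p b' = placeResidueMap p b ^ p :=
        hres b b' (valuation_smul_sub_pow_lt_one_of_isArithFrobAt hmem hv h𝔓 hσ hy)
      change geomReduction hΔ (Affine.Point.some (a' : AlgebraicClosure ℚ) b' hσxy) =
        φ • geomReduction hΔ (Affine.Point.some (a : AlgebraicClosure ℚ) b hxy)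
      rw [hred₁, hred₂]
      -- `φ • (u, w) = (φ u, φ w) = (u^p, w^p)` (definitionally `Affine.Point.map`)
      have hφns : ((reductionModPrime W p).baseChange (AlgebraicClosure (ZMod p))).toAffine.Nonsingular
          (φ • placeResidueMap p a) (φ • placeResidueMap p b) := by
        rw [hφ, hφ, ← hra, ← hrb]; exact h₂
      change _ = (Affine.Point.some (φ • placeResidueMap p a) (φ • placeResidueMap p b) hφns : _)
      exact point_some_congr (by rw [hra, hφ]) (by rw [hrb, hφ])
    · -- `x ∉ 𝒪`: both reduce to `Õ`
      have hx' : 1 < (placeOver p).valuation x := by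
        rw [← not_le, ValuationSubring.valuation_le_one_iff]; exact hx
      have hσx' : 1 < (placeOver p).valuation (σ • x) := by
        rw [← not_le, ValuationSubring.valuation_le_one_iff, hmemσ]; exact hx
      rw [geomReduction_some_of_one_lt hΔ hσxy hσx', geomReduction_some_of_one_lt hΔ hxy hx',
        smul_zero]

/-! ### On the `p`-torsion of `Ẽ` the Frobenius is the scalar `a_p` -/

/-- **Frobenius acts on `Ẽ(𝔽̄_p)[p]` as multiplication by `a_p`.** For `W/ℚ` globally minimal,
`p ∤ Δ_W`, the `p`-power Frobenius `φ ∈ Γ_{𝔽_p}` and `Q ∈ Ẽ(𝔽̄_p)` with `p • Q = 0`: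
`φ • Q = a_p • Q`, `a_p = W.frobeniusTrace p = p + 1 - #Ẽ(𝔽_p)`. From Manin's relation
`φ(φ R) - a_p φ R + p R = 0` on `Ẽ(𝔽̄_p)` (tree `frobenius_frobenius_sub_trace_smul_add_card_smul`,
Silverman AEC V.2.3.1) at the `p`-torsion point `R = φ⁻¹ Q`. (On `Ẽ[p^k]`, `k ≥ 2`, the Frobenius
is the unit root of `X² - a_p X + p`, congruent to `a_p` only modulo `p`; not needed here.)
[cite: SilvermanAEC2009, Thm. V.2.3.1(b)] -/
theorem frob_smul_eq_frobeniusTrace_smul_of_zsmul_eq_zero {W : WeierstrassCurve ℚ}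
    [W.IsGloballyMinimal] (hΔ : ¬ (p : ℤ) ∣ minimalDiscriminantInt W)
    {φ : absoluteGaloisGroup (ZMod p)} (hφ : ∀ x : AlgebraicClosure (ZMod p), φ • x = x ^ p)
    (Q : (reductionModPrime W p).geomPoints) (hQ : (p : ℤ) • Q = 0) :
    φ • Q = (W.frobeniusTrace p) • Q := by
  haveI : (reductionModPrime W p).IsElliptic := isElliptic_reductionModPrime W hΔ
  have hcard : Nat.card (ZMod p) = p := Nat.card_zmod p
  have hφ' : ∀ x : AlgebraicClosure (ZMod p), φ • x = x ^ Nat.card (ZMod p) := by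
    rw [hcard]; exact hφ
  -- Manin's relation at `R = φ⁻¹ • Q`
  set R : (reductionModPrime W p).geomPoints := φ⁻¹ • Q with hR
  have hφR : φ • R = Q := smul_inv_smul φ Q
  have hpR : ((p : ℕ) : ℤ) • R = 0 := by
    rw [hR, smul_comm, hQ, smul_zero]
  have hrel := (reductionModPrime W p).frobenius_frobenius_sub_trace_smul_add_card_smul hφ' R
  rw [hcard, ← frobeniusTrace_eq_sub_natCard_reductionModPrime W p, hφR, hpR, add_zero,
    sub_eq_zero] at hrel
  exact hrel

/-! ### Frobenius on `E[p]` modulo the kernel of reduction: the scalar `a_p` -/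

/-- **`red (σ • P) = a_p • red P` for every `P ∈ E[p](ℚ̄)`** (Serre 1972, §1.11 (1): at a good
prime the Frobenius acts on `E[p]/X_p ≅ red(E[p]) ⊆ Ẽ[p]`, `X_p = ker (red|E[p])`, through the
Frobenius of `𝔽̄_p`, i.e. by the scalar `a_p (mod p)` — the unramified character of `ρ̄_{E,p}|_{G_p}`
evaluated at Frobenius). Here `σ ∈ Γ_ℚ` is an arithmetic Frobenius at the prime `𝔓` of the place,
`red = geomReduction hΔ`. [cite: Serre1972, §1.11 (1) and Prop. 11] -/
theorem geomReduction_smul_eq_frobeniusTrace_smul {W : WeierstrassCurve ℚ} [W.IsGloballyMinimal]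
    [W.IsElliptic] (hΔ : ¬ (p : ℤ) ∣ minimalDiscriminantInt W)
    {𝔓 : Ideal (absIntegers (𝓞 ℚ) ℚ)}
    (hmem : ∀ x : absIntegers (𝓞 ℚ) ℚ, x ∈ 𝔓 ↔ (x : AlgebraicClosure ℚ) ∈ (placeOver p).nonunits)
    {v : HeightOneSpectrum (𝓞 ℚ)} (hv : (primesEquiv v : ℕ) = p) (h𝔓 : 𝔓 ∈ v.primesAbove)
    {σ : absoluteGaloisGroup ℚ} (hσ : IsArithFrobAt (𝓞 ℚ) σ 𝔓)
    (P : W.geomPoints) (hP : (p : ℤ) • P = 0) :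
    geomReduction hΔ (σ • P) = (W.frobeniusTrace p) • geomReduction hΔ P := by
  obtain ⟨φ, hφ⟩ := exists_frobenius_absoluteGaloisGroup (ZMod p)
  have hφp : ∀ x : AlgebraicClosure (ZMod p), φ • x = x ^ p := by
    intro x; rw [hφ x, Nat.card_zmod]
  rw [geomReduction_smul_of_isArithFrobAt hΔ hmem hv h𝔓 hσ hφp P]
  refine frob_smul_eq_frobeniusTrace_smul_of_zsmul_eq_zero hΔ hφp _ ?_
  rw [← map_zsmul, hP, map_zero]

/-- Equivalently: **`σ • P - a_p • P` lies in the kernel of reduction** for every `P ∈ E[p](ℚ̄)`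
(Frobenius is the scalar `a_p` on `E[p]` modulo `X_p`). [cite: Serre1972, §1.11 (1) and Prop. 11] -/
theorem geomReduction_smul_sub_frobeniusTrace_smul_eq_zero {W : WeierstrassCurve ℚ}
    [W.IsGloballyMinimal] [W.IsElliptic] (hΔ : ¬ (p : ℤ) ∣ minimalDiscriminantInt W)
    {𝔓 : Ideal (absIntegers (𝓞 ℚ) ℚ)}
    (hmem : ∀ x : absIntegers (𝓞 ℚ) ℚ, x ∈ 𝔓 ↔ (x : AlgebraicClosure ℚ) ∈ (placeOver p).nonunits)
    {v : HeightOneSpectrum (𝓞 ℚ)} (hv : (primesEquiv v : ℕ) = p) (h𝔓 : 𝔓 ∈ v.primesAbove)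
    {σ : absoluteGaloisGroup ℚ} (hσ : IsArithFrobAt (𝓞 ℚ) σ 𝔓)
    (P : W.geomPoints) (hP : (p : ℤ) • P = 0) :
    geomReduction hΔ (σ • P - (W.frobeniusTrace p) • P) = 0 := by
  rw [map_sub, map_zsmul, geomReduction_smul_eq_frobeniusTrace_smul hΔ hmem hv h𝔓 hσ P hP, sub_self]

/-! ### The two halves of the "anomalous" dictionary -/

/-- **`a_p ≡ 1 (mod p)` ⇒ the Frobenius acts trivially on `E[p]` modulo the kernel of reduction**:
`red (σ • P) = red P` for every `P ∈ E[p](ℚ̄)` (`(a_p - 1) • red P = 0` because `p • red P = 0`).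
[cite: Serre1972, §1.11 (1)] [cite: Mazur1972, §1 (anomalous primes)] -/
theorem geomReduction_smul_eq_self_of_dvd_frobeniusTrace_sub_one {W : WeierstrassCurve ℚ}
    [W.IsGloballyMinimal] [W.IsElliptic] (hΔ : ¬ (p : ℤ) ∣ minimalDiscriminantInt W)
    {𝔓 : Ideal (absIntegers (𝓞 ℚ) ℚ)}
    (hmem : ∀ x : absIntegers (𝓞 ℚ) ℚ, x ∈ 𝔓 ↔ (x : AlgebraicClosure ℚ) ∈ (placeOver p).nonunits)
    {v : HeightOneSpectrum (𝓞 ℚ)} (hv : (primesEquiv v : ℕ) = p) (h𝔓 : 𝔓 ∈ v.primesAbove)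
    {σ : absoluteGaloisGroup ℚ} (hσ : IsArithFrobAt (𝓞 ℚ) σ 𝔓)
    (ha : (p : ℤ) ∣ W.frobeniusTrace p - 1) (P : W.geomPoints) (hP : (p : ℤ) • P = 0) :
    geomReduction hΔ (σ • P) = geomReduction hΔ P := by
  obtain ⟨c, hc⟩ := ha
  have hpQ : (p : ℤ) • geomReduction hΔ P = 0 := by rw [← map_zsmul, hP, map_zero]
  rw [geomReduction_smul_eq_frobeniusTrace_smul hΔ hmem hv h𝔓 hσ P hP,
    show W.frobeniusTrace p = 1 + (p : ℤ) * c by rw [← hc]; ring, add_smul, one_smul, mul_comm,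
    mul_smul, hpQ, smul_zero, add_zero]

/-- **Conversely, one `P ∈ E[p](ℚ̄)` with `red P ≠ Õ` fixed modulo the kernel by the Frobenius forces
`a_p ≡ 1 (mod p)`**: `(a_p - 1) • red P = 0` with `red P` of order `p`.
[cite: Serre1972, §1.11 (1)] [cite: Mazur1972, §1 (anomalous primes)] -/
theorem dvd_frobeniusTrace_sub_one_of_geomReduction_smul_eq_self {W : WeierstrassCurve ℚ}
    [W.IsGloballyMinimal] [W.IsElliptic] (hΔ : ¬ (p : ℤ) ∣ minimalDiscriminantInt W)
    {𝔓 : Ideal (absIntegers (𝓞 ℚ) ℚ)}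
    (hmem : ∀ x : absIntegers (𝓞 ℚ) ℚ, x ∈ 𝔓 ↔ (x : AlgebraicClosure ℚ) ∈ (placeOver p).nonunits)
    {v : HeightOneSpectrum (𝓞 ℚ)} (hv : (primesEquiv v : ℕ) = p) (h𝔓 : 𝔓 ∈ v.primesAbove)
    {σ : absoluteGaloisGroup ℚ} (hσ : IsArithFrobAt (𝓞 ℚ) σ 𝔓)
    {P : W.geomPoints} (hP : (p : ℤ) • P = 0) (hred : geomReduction hΔ P ≠ 0)
    (hfix : geomReduction hΔ (σ • P) = geomReduction hΔ P) :
    (p : ℤ) ∣ W.frobeniusTrace p - 1 := by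
  set Q := geomReduction hΔ P with hQ
  have hpQ : (p : ℤ) • Q = 0 := by rw [hQ, ← map_zsmul, hP, map_zero]
  have h1 : (W.frobeniusTrace p - 1) • Q = 0 := by
    rw [sub_smul, one_smul, ← geomReduction_smul_eq_frobeniusTrace_smul hΔ hmem hv h𝔓 hσ P hP,
      hfix, sub_self]
  -- the order of `Q` is `p`
  have hord : addOrderOf Q = p := by
    have hfin : IsOfFinAddOrder Q := by
      rw [isOfFinAddOrder_iff_zsmul_eq_zero]
      exact ⟨p, by exact_mod_cast (Fact.out : p.Prime).ne_zero, hpQ⟩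
    have hdvd : addOrderOf Q ∣ p := by
      apply addOrderOf_dvd_of_nsmul_eq_zero
      rw [← natCast_zsmul]; exact hpQ
    rcases (Nat.dvd_prime (Fact.out : p.Prime)).mp hdvd with h | h
    · exact absurd (AddMonoid.addOrderOf_eq_one_iff.mp h) hred
    · exact h
  have h2 : (addOrderOf Q : ℤ) ∣ W.frobeniusTrace p - 1 :=
    (addOrderOf_dvd_iff_zsmul_eq_zero).mpr h1
  rwa [hord] at h2

/-! ### Existence of the Frobenius at the place -/

/-- **There is an arithmetic Frobenius at the prime of the place**: a prime `𝔓` of `ar ℤ` with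
`𝔓 = 𝔪_{placeOver p} ∩ ar ℤ` (the hypothesis shape `hmem` of this file and of
`SerreOpenImageReductionInertiaProofs`) lying above the place `v` of `ℚ` at `p`, and `σ ∈ Γ_ℚ` with
`IsArithFrobAt (𝓞 ℚ) σ 𝔓` (tree: `exists_ideal_placeOver`, `exists_isArithFrobAt_of_mem_primesAbove_holds`).
[cite: SerreAbelianLadic1968, Ch. I §2.1] -/
theorem exists_isArithFrobAt_placeOver (p : ℕ) [Fact p.Prime] :
    ∃ (v : HeightOneSpectrum (𝓞 ℚ)) (𝔓 : Ideal (absIntegers (𝓞 ℚ) ℚ)) (σ : absoluteGaloisGroup ℚ),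
      (primesEquiv v : ℕ) = p ∧
      (∀ x : absIntegers (𝓞 ℚ) ℚ, x ∈ 𝔓 ↔ (x : AlgebraicClosure ℚ) ∈ (placeOver p).nonunits) ∧
      𝔓 ∈ v.primesAbove ∧ IsArithFrobAt (𝓞 ℚ) σ 𝔓 := by
  set v : HeightOneSpectrum (𝓞 ℚ) := primesEquiv.symm ⟨p, Fact.out⟩ with hvdef
  have hv : (primesEquiv v : ℕ) = p := by rw [hvdef, Equiv.apply_symm_apply]
  obtain ⟨𝔓, hmem, h𝔓⟩ := exists_ideal_placeOver p hv
  obtain ⟨σ, hσ⟩ := HeightOneSpectrum.exists_isArithFrobAt_of_mem_primesAbove_holds (K := ℚ) (v := v) h𝔓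
  exact ⟨v, 𝔓, σ, hv, hmem, h𝔓, hσ⟩

end Literature.NumberTheory.EllipticCurves

end
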